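import Literature.AlgebraicGeometry.RealAlgebraic.SemialgebraicTangent
import HarnessLib

/-!
# The invariant coframe of a compact abelian Nash group embedded in `ℝᴺ`

Let `pts ⊆ ℝᴺ` be a compact `ℚ`-semialgebraic `C^∞` submanifold of dimension `g` carrying a
commutative group law `add`, `zero`, `neg` given by `C^∞` maps of the ambient spaces which are
`ℚ`-semialgebraic on `pts × pts`, resp. `pts` (`EmbeddedNashGroup N g`; the real points `J(ℝ)` of
an abelian variety over a real-algebraic field, embedded by algebraic coordinates, are of this
shape — files `RealAlgebraic/RealAlgebraicMorphisms`, `RealAlgebraic/ProductCoordinates`). This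
file constructs the **invariant coframe** required by
`Literature.AlgebraicGeometry.RealAlgebraic.CompactAbelianNashGroup` (file
`RealAlgebraic/RealAbelJacobi`) and packages everything as
`EmbeddedNashGroup.toCompactAbelianNashGroup`:

  `ωᵢ(x)(v) = (D(y ↦ (−x) + y)(x) (π_x v))_{Jᵢ}`,

where `π_x` is the orthogonal projection onto the tangent space `T_x` (extended smoothly off
`pts`, `IsSubmanifoldOfDim.exists_contDiff_orthProj`), `D(τ_x)(x) : T_x → T_0` the differential
of the translation `τ_x : y ↦ (−x) + y`, and `J₁, …, J_g` coordinates of `ℝᴺ` restricting to a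
basis of `T_0^*` (`exists_coords_of_subspace`). We prove:

* smoothness (`ContDiff`, by `ContDiff.fderiv` and `ContDiff.clm_comp`);
* **`ℚ`-semialgebraicity of the coefficients** `x ↦ ωᵢ(x)(e_j)` on `pts`
  (`isSemialgebraicFunOn_invForm`): `π_x e_j` is semialgebraic in `x`
  (`isSemialgebraicMapOn_orthProj_single`) and the derivative of the semialgebraic map
  `(a, y) ↦ (−a) + y` along the semialgebraic tangent field `(0, π_x e_j)` of `pts × pts` is
  semialgebraic (`isSemialgebraicMapOn_fderiv_apply`);
* **additivity** `ρ^*ω = pr₁^*ω + pr₂^*ω` on tangent vectors (`invForm_add`): in the commutative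
  group, `τ_{a+b}(p + q) = τ_a p + τ_b q`, and the differential of the group law at `(0, 0)` is
  addition (Serre, *Algebraic Groups and Class Fields*, III no. 11, Prop. 17, proof; Lee,
  *Introduction to Smooth Manifolds*, Problem 7-2: `dm_{(e,e)}(X, Y) = X + Y`);
* **the frame property** (`invForm_frame`): `D(τ_x)(x) : T_x ≅ T_0` and the `J`-coordinates are
  a basis of `T_0^*` (Serre III.11, Cor. 1 to Prop. 16).

Standard Lie-group material; no named fact is introduced.

## References

* J.-P. Serre, *Algebraic Groups and Class Fields*, GTM 117 (1988), Ch. III no. 11, Prop. 16,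
  Cor. 1, Prop. 17. [Serre1988]
* J. M. Lee, *Introduction to Smooth Manifolds*, 2nd ed. (2013), Problem 7-2
  (`dm_{(e,e)}(X, Y) = X + Y`). [LeeSmoothManifolds2013]
* J. Bochnak, M. Coste, M.-F. Roy, *Real Algebraic Geometry* (1998), Prop. 2.2.4, Prop. 2.2.6,
  Prop. 3.3.11. [BochnakCosteRoy1998]
* S. Basu, R. Pollack, M.-F. Roy, *Algorithms in Real Algebraic Geometry*, 2nd ed. (2006),
  Prop. 3.22 and §3.3. [BasuPollackRoy2006]
-/

noncomputable section

open Set Filter Function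
open scoped ContDiff Topology Matrix

namespace Literature.AlgebraicGeometry.RealAlgebraic

open Literature.ModelTheory.ExponentialFields Literature.NumberTheory.Transcendental

/-! ### Linear algebra: coordinates adapted to a subspace -/

section Coords

variable {N g : ℕ}

/-- **Coordinates adapted to a subspace.** For a `g`-dimensional subspace `K ⊆ ℝᴺ` there are `g`
coordinate indices `J₁, …, J_g` such that the coordinate functionals `v ↦ v_{Jᵢ}` restrict to a
basis of `K^*`: they separate the points of `K`, and no non-trivial combination `Σ cᵢ v_{Jᵢ}`
vanishes on `K` (extract a basis of `K` from the spanning family `π_K e_j`, `π_K` the orthogonal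
projection). [folklore] -/
theorem exists_coords_of_subspace (K : Submodule ℝ (Fin N → ℝ)) (hK : Module.finrank ℝ K = g) :
    ∃ J : Fin g → Fin N,
      (∀ v ∈ K, (∀ i, v (J i) = 0) → v = 0) ∧
      (∀ c : Fin g → ℝ, (∀ v ∈ K, ∑ i, c i * v (J i) = 0) → c = 0) := by
  classical
  set r : Fin N → (Fin N → ℝ) := fun j => orthProj K (Pi.single j 1) with hr
  -- `span (range r) = K`
  have hrK : ∀ j, r j ∈ K := fun j => orthProj_mem K _
  have hspan : Submodule.span ℝ (Set.range r) = K := by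
    refine le_antisymm (Submodule.span_le.mpr ?_) fun v hv => ?_
    · rintro _ ⟨j, rfl⟩
      exact hrK j
    · have hv' : v = ∑ j, v j • r j := by
        have h1 : v = ∑ j, v j • Pi.basisFun ℝ (Fin N) j := by
          conv_lhs => rw [← (Pi.basisFun ℝ (Fin N)).sum_repr v]
          simp [Pi.basisFun_repr]
        calc v = orthProj K v := (orthProj_eq_self K hv).symm
          _ = orthProj K (∑ j, v j • Pi.basisFun ℝ (Fin N) j) := by rw [← h1]
          _ = ∑ j, v j • r j := by simp [hr, map_sum, map_smul, Pi.basisFun_apply]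
      rw [hv']
      exact Submodule.sum_mem _ fun j _ => Submodule.smul_mem _ _ (Submodule.subset_span ⟨j, rfl⟩)
  -- extract a basis
  obtain ⟨κ, a, ha, hspan', hli⟩ := exists_linearIndependent' (K := ℝ) r
  haveI : Fintype κ := Fintype.ofInjective a ha
  have hcard : Fintype.card κ = g := by
    rw [← hK, ← finrank_span_eq_card hli, hspan', hspan]
  set e : Fin g ≃ κ := (Fintype.equivFinOfCardEq hcard).symm with he
  set J : Fin g → Fin N := a ∘ e with hJ
  have hliJ : LinearIndependent ℝ (fun i => r (J i)) := by
    have h := hli.comp e e.injective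
    exact h
  have hspanJ : Submodule.span ℝ (Set.range fun i => r (J i)) = K := by
    rw [← hspan, ← hspan']
    congr 1
    ext w
    simp only [Set.mem_range, Function.comp_apply, hJ]
    constructor
    · rintro ⟨i, rfl⟩
      exact ⟨e i, rfl⟩
    · rintro ⟨x, rfl⟩
      exact ⟨e.symm x, by simp⟩
  -- dot products with the `r (J i)` are the coordinates `J i` on `K`
  have hdot : ∀ v ∈ K, ∀ j, v ⬝ᵥ r j = v j := fun v hv j => by
    rw [hr]
    change v ⬝ᵥ orthProj K (Pi.single j 1) = v j
    rw [← dotProduct_orthProj_comm, orthProj_eq_self K hv, dotProduct_single, mul_one]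
  refine ⟨J, fun v hv h0 => ?_, fun c hc => ?_⟩
  · -- separation
    have horth : ∀ w ∈ Submodule.span ℝ (Set.range fun i => r (J i)), v ⬝ᵥ w = 0 := by
      intro w hw
      induction hw using Submodule.span_induction with
      | mem w hw =>
        obtain ⟨i, rfl⟩ := hw
        rw [hdot v hv, h0 i]
      | zero => simp
      | add w₁ w₂ _ _ h₁ h₂ => rw [dotProduct_add, h₁, h₂, add_zero]
      | smul t w _ h => rw [dotProduct_smul, h, smul_zero]
    have hvv : v ⬝ᵥ v = 0 := horth v (hspanJ ▸ hv)
    exact dotProduct_self_eq_zero.mp hvv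
  · -- independence
    set w : Fin N → ℝ := ∑ i, c i • r (J i) with hw
    have hwK : w ∈ K := Submodule.sum_mem _ fun i _ => Submodule.smul_mem _ _ (hrK _)
    have hvw : ∀ v ∈ K, v ⬝ᵥ w = 0 := fun v hv => by
      rw [hw, dotProduct_sum]
      simp only [dotProduct_smul, smul_eq_mul]
      rw [← hc v hv]
      refine Finset.sum_congr rfl fun i _ => ?_
      rw [hdot v hv]
    have hw0 : w = 0 := dotProduct_self_eq_zero.mp (hvw w hwK)
    have h := Fintype.linearIndependent_iff.mp hliJ c (by rw [← hw]; exact hw0)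
    exact funext h

end Coords

/-! ### Embedded Nash groups: the input data -/

/-- **An embedded compact abelian Nash group**: a compact `ℚ`-semialgebraic `g`-dimensional `C^∞`
submanifold `pts ⊆ ℝᴺ` with a commutative group law `add`, `zero`, `neg` on `pts` given by `C^∞`
maps of the ambient spaces (`add` jointly `C^∞` on `ℝᴺ × ℝᴺ`), `ℚ`-semialgebraic on `pts × pts`,
resp. `pts`. The real points of an abelian variety over a real-algebraic field in algebraic
coordinates are of this shape. (Data only; the coframe is *constructed* below.)
[cite: Serre1988, Ch. III no. 11] -/
structure EmbeddedNashGroup (N g : ℕ) where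
  /-- The underlying set `A(ℝ) ⊆ ℝᴺ`. -/
  pts : Set (Fin N → ℝ)
  isCompact_pts : IsCompact pts
  isSemialgebraic_pts : IsSemialgebraic ℚ pts
  isSubmanifold_pts : IsSubmanifoldOfDim g pts
  /-- The group law (ambient). -/
  add : (Fin N → ℝ) → (Fin N → ℝ) → (Fin N → ℝ)
  /-- The neutral element. -/
  zero : Fin N → ℝ
  /-- The inversion (ambient). -/
  neg : (Fin N → ℝ) → (Fin N → ℝ)
  contDiff_add : ContDiff ℝ ∞ fun p : (Fin N → ℝ) × (Fin N → ℝ) => add p.1 p.2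
  contDiff_neg : ContDiff ℝ ∞ neg
  isSemialgebraicMapOn_add : IsSemialgebraicMapOn ℚ (appendProd pts pts)
    (fun z => add (fun i => z (Fin.castAdd N i)) (fun j => z (Fin.natAdd N j)))
  isSemialgebraicMapOn_neg : IsSemialgebraicMapOn ℚ pts neg
  zero_mem : zero ∈ pts
  add_mem : ∀ ⦃x⦄, x ∈ pts → ∀ ⦃y⦄, y ∈ pts → add x y ∈ pts
  neg_mem : ∀ ⦃x⦄, x ∈ pts → neg x ∈ pts
  add_assoc : ∀ x ∈ pts, ∀ y ∈ pts, ∀ z ∈ pts, add (add x y) z = add x (add y z)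
  add_comm : ∀ x ∈ pts, ∀ y ∈ pts, add x y = add y x
  zero_add : ∀ x ∈ pts, add zero x = x
  neg_add_cancel : ∀ x ∈ pts, add (neg x) x = zero

namespace EmbeddedNashGroup

variable {N g : ℕ} (G : EmbeddedNashGroup N g)

/-! ### Group-law consequences on `pts` -/

/-- `x + 0 = x`. [folklore] -/
theorem add_zero {x : Fin N → ℝ} (hx : x ∈ G.pts) : G.add x G.zero = x := by
  rw [G.add_comm x hx _ G.zero_mem, G.zero_add x hx]

/-- `x + (−x) = 0`. [folklore] -/
theorem add_neg_cancel {x : Fin N → ℝ} (hx : x ∈ G.pts) : G.add x (G.neg x) = G.zero := by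
  rw [G.add_comm x hx _ (G.neg_mem hx), G.neg_add_cancel x hx]

/-- Left cancellation. [folklore] -/
theorem add_left_cancel {x y z : Fin N → ℝ} (hx : x ∈ G.pts) (hy : y ∈ G.pts) (hz : z ∈ G.pts)
    (h : G.add x y = G.add x z) : y = z := by
  have h' := congrArg (G.add (G.neg x)) h
  rwa [← G.add_assoc _ (G.neg_mem hx) x hx y hy, ← G.add_assoc _ (G.neg_mem hx) x hx z hz,
    G.neg_add_cancel x hx, G.zero_add y hy, G.zero_add z hz] at h'

/-- `−(a + b) = (−a) + (−b)`. [folklore] -/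
theorem neg_add {a b : Fin N → ℝ} (ha : a ∈ G.pts) (hb : b ∈ G.pts) :
    G.neg (G.add a b) = G.add (G.neg a) (G.neg b) := by
  have hab : G.add a b ∈ G.pts := G.add_mem ha hb
  refine G.add_left_cancel hab (G.neg_mem hab) (G.add_mem (G.neg_mem ha) (G.neg_mem hb)) ?_
  rw [G.add_neg_cancel hab]
  -- `(a + b) + ((−a) + (−b)) = 0`
  calc G.zero = G.add (G.add a (G.neg a)) (G.add b (G.neg b)) := by
        rw [G.add_neg_cancel ha, G.add_neg_cancel hb, G.zero_add _ G.zero_mem]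
    _ = G.add a (G.add (G.neg a) (G.add b (G.neg b))) :=
        G.add_assoc a ha _ (G.neg_mem ha) _ (G.add_mem hb (G.neg_mem hb))
    _ = G.add a (G.add (G.add (G.neg a) b) (G.neg b)) := by
        rw [G.add_assoc _ (G.neg_mem ha) b hb _ (G.neg_mem hb)]
    _ = G.add a (G.add (G.add b (G.neg a)) (G.neg b)) := by
        rw [G.add_comm _ (G.neg_mem ha) b hb]
    _ = G.add a (G.add b (G.add (G.neg a) (G.neg b))) := by
        rw [G.add_assoc b hb _ (G.neg_mem ha) _ (G.neg_mem hb)]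
    _ = G.add (G.add a b) (G.add (G.neg a) (G.neg b)) :=
        (G.add_assoc a ha b hb _ (G.add_mem (G.neg_mem ha) (G.neg_mem hb))).symm

/-- **`τ_{a+b}(p + q) = τ_a(p) + τ_b(q)`** in the commutative group:
`(−(a+b)) + (p + q) = ((−a) + p) + ((−b) + q)`. [folklore] -/
theorem neg_add_add_add {a b p q : Fin N → ℝ} (ha : a ∈ G.pts) (hb : b ∈ G.pts) (hp : p ∈ G.pts)
    (hq : q ∈ G.pts) :
    G.add (G.neg (G.add a b)) (G.add p q) = G.add (G.add (G.neg a) p) (G.add (G.neg b) q) := by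
  have hna := G.neg_mem ha
  have hnb := G.neg_mem hb
  rw [G.neg_add ha hb]
  calc G.add (G.add (G.neg a) (G.neg b)) (G.add p q)
      = G.add (G.neg a) (G.add (G.neg b) (G.add p q)) := G.add_assoc _ hna _ hnb _ (G.add_mem hp hq)
    _ = G.add (G.neg a) (G.add (G.add (G.neg b) p) q) := by rw [G.add_assoc _ hnb p hp q hq]
    _ = G.add (G.neg a) (G.add (G.add p (G.neg b)) q) := by rw [G.add_comm _ hnb p hp]
    _ = G.add (G.neg a) (G.add p (G.add (G.neg b) q)) := by rw [G.add_assoc p hp _ hnb q hq]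
    _ = G.add (G.add (G.neg a) p) (G.add (G.neg b) q) :=
        (G.add_assoc _ hna p hp _ (G.add_mem hnb hq)).symm

/-- `τ_x x = 0`. [folklore] -/
theorem neg_add_self {x : Fin N → ℝ} (hx : x ∈ G.pts) : G.add (G.neg x) x = G.zero :=
  G.neg_add_cancel x hx

/-- `σ_x (τ_x y) = y`: `x + ((−x) + y) = y`. [folklore] -/
theorem add_neg_add {x y : Fin N → ℝ} (hx : x ∈ G.pts) (hy : y ∈ G.pts) :
    G.add x (G.add (G.neg x) y) = y := by
  rw [← G.add_assoc x hx _ (G.neg_mem hx) y hy, G.add_neg_cancel hx, G.zero_add y hy]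

/-- `τ_x (σ_x y) = y`: `(−x) + (x + y) = y`. [folklore] -/
theorem neg_add_add {x y : Fin N → ℝ} (hx : x ∈ G.pts) (hy : y ∈ G.pts) :
    G.add (G.neg x) (G.add x y) = y := by
  rw [← G.add_assoc _ (G.neg_mem hx) x hx y hy, G.neg_add_cancel x hx, G.zero_add y hy]

/-! ### Smoothness of the structure maps -/

/-- `y ↦ a + y` is `C^∞` (for any fixed `a`). [folklore] -/
theorem contDiff_add_right (a : Fin N → ℝ) : ContDiff ℝ ∞ fun y => G.add a y :=
  G.contDiff_add.comp (contDiff_const.prodMk contDiff_id)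

/-- `x ↦ x + b` is `C^∞`. [folklore] -/
theorem contDiff_add_left (b : Fin N → ℝ) : ContDiff ℝ ∞ fun x => G.add x b :=
  G.contDiff_add.comp (contDiff_id.prodMk contDiff_const)

/-- `(x, y) ↦ (−x) + y` is jointly `C^∞`. [folklore] -/
theorem contDiff_neg_add :
    ContDiff ℝ ∞ (Function.uncurry fun x y : Fin N → ℝ => G.add (G.neg x) y) :=
  G.contDiff_add.comp ((G.contDiff_neg.comp contDiff_fst).prodMk contDiff_snd)

/-- `τ_x : y ↦ (−x) + y` is `C^∞`. [folklore] -/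
theorem contDiff_tau (x : Fin N → ℝ) : ContDiff ℝ ∞ fun y => G.add (G.neg x) y :=
  G.contDiff_add_right _

/-! ### The coframe: definitions -/

/-- The tangent space `T_x` of `pts`. [folklore] -/
abbrev T (x : Fin N → ℝ) : Submodule ℝ (Fin N → ℝ) := tangentSpace G.pts x

/-- A `C^∞` field of continuous linear maps equal on `pts` to the orthogonal projection onto the
tangent spaces (choice, `IsSubmanifoldOfDim.exists_contDiff_orthProj`). [folklore] -/
def proj : (Fin N → ℝ) → ((Fin N → ℝ) →L[ℝ] (Fin N → ℝ)) :=
  (G.isSubmanifold_pts.exists_contDiff_orthProj G.isCompact_pts.isClosed).choose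

/-- The projection field is `C^∞`. [folklore] -/
theorem contDiff_proj : ContDiff ℝ ∞ G.proj :=
  (G.isSubmanifold_pts.exists_contDiff_orthProj G.isCompact_pts.isClosed).choose_spec.1

/-- On `pts` the projection field is the orthogonal projection onto `T_x`. [folklore] -/
theorem proj_eq {x : Fin N → ℝ} (hx : x ∈ G.pts) : G.proj x = orthProj (G.T x) :=
  (G.isSubmanifold_pts.exists_contDiff_orthProj G.isCompact_pts.isClosed).choose_spec.2 x hx

/-- The differential `D(τ_x)(x)` of the translation `τ_x : y ↦ (−x) + y` at `x`. [folklore] -/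
def dtau (x : Fin N → ℝ) : (Fin N → ℝ) →L[ℝ] (Fin N → ℝ) :=
  fderiv ℝ (fun y => G.add (G.neg x) y) x

/-- `x ↦ D(τ_x)(x)` is `C^∞` (`ContDiff.fderiv` for the jointly smooth `(x, y) ↦ (−x) + y`).
[folklore] -/
theorem contDiff_dtau : ContDiff ℝ ∞ G.dtau :=
  ContDiff.fderiv (f := fun x y : Fin N → ℝ => G.add (G.neg x) y) (g := id) G.contDiff_neg_add
    contDiff_id le_rfl

/-- The transport map `L(x) = D(τ_x)(x) ∘ π_x : ℝᴺ → ℝᴺ` (on `pts`: project to `T_x`, then carry to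
`T_0`). [folklore] -/
def transport (x : Fin N → ℝ) : (Fin N → ℝ) →L[ℝ] (Fin N → ℝ) := (G.dtau x).comp (G.proj x)

/-- The transport field is `C^∞`. [folklore] -/
theorem contDiff_transport : ContDiff ℝ ∞ G.transport :=
  G.contDiff_dtau.clm_comp G.contDiff_proj

/-- `T_0` is `g`-dimensional. [folklore] -/
theorem finrank_T_zero : Module.finrank ℝ (G.T G.zero) = g :=
  finrank_tangentSpace G.isSubmanifold_pts G.zero_mem

/-- The adapted coordinates `J₁, …, J_g` of `T_0` (choice, `exists_coords_of_subspace`).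
[folklore] -/
def J : Fin g → Fin N := (exists_coords_of_subspace (G.T G.zero) G.finrank_T_zero).choose

/-- The coordinates `J` separate `T_0`. [folklore] -/
theorem J_separates {v : Fin N → ℝ} (hv : v ∈ G.T G.zero) (h : ∀ i, v (G.J i) = 0) : v = 0 :=
  (exists_coords_of_subspace (G.T G.zero) G.finrank_T_zero).choose_spec.1 v hv h

/-- The coordinate functionals `J` are independent on `T_0`. [folklore] -/
theorem J_independent {c : Fin g → ℝ} (h : ∀ v ∈ G.T G.zero, ∑ i, c i * v (G.J i) = 0) : c = 0 :=
  (exists_coords_of_subspace (G.T G.zero) G.finrank_T_zero).choose_spec.2 c h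

/-- **The invariant coframe** `ωᵢ(x)(v) = (D(τ_x)(x) (π_x v))_{Jᵢ}`.
[cite: Serre1988, Ch. III no. 11, Prop. 16 Cor. 1] -/
def invForm (i : Fin g) (x : Fin N → ℝ) : (Fin N → ℝ) →L[ℝ] ℝ :=
  (ContinuousLinearMap.proj (G.J i)).comp (G.transport x)

/-- Unfolding of `invForm`. [folklore] -/
theorem invForm_apply (i : Fin g) (x v : Fin N → ℝ) :
    G.invForm i x v = G.dtau x (G.proj x v) (G.J i) :=
  rfl

/-- Each `ωᵢ` is `C^∞` on `ℝᴺ`. [folklore] -/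
theorem contDiff_invForm (i : Fin g) : ContDiff ℝ ∞ (G.invForm i) :=
  (contDiff_const (c := ContinuousLinearMap.proj (R := ℝ) (φ := fun _ : Fin N => ℝ) (G.J i))).clm_comp
    G.contDiff_transport

end EmbeddedNashGroup

/-! ### Products of submanifolds; the tangent vector `(0, u)` -/

section Products

variable {m n dm dn : ℕ}

/-- The unit ball of `ℝ^{m+n}` (sup norm) is the product of the unit balls. [folklore] -/
theorem mem_ball_append_iff (t : Fin (m + n) → ℝ) :
    t ∈ Metric.ball (0 : Fin (m + n) → ℝ) 1 ↔
      (fun i => t (Fin.castAdd n i)) ∈ Metric.ball (0 : Fin m → ℝ) 1 ∧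
        (fun j => t (Fin.natAdd m j)) ∈ Metric.ball (0 : Fin n → ℝ) 1 := by
  simp only [mem_ball_zero_iff, pi_norm_lt_iff zero_lt_one]
  constructor
  · intro h
    exact ⟨fun i => h _, fun j => h _⟩
  · rintro ⟨h1, h2⟩ i
    exact Fin.addCases (motive := fun i => ‖t i‖ < 1) (fun i => h1 i) (fun j => h2 j) i

/-- The block projections of `ℝ^{m+n}` are `C^∞`. [folklore] -/
theorem contDiff_fstBlock : ContDiff ℝ ∞ fun z : Fin (m + n) → ℝ => fun i => z (Fin.castAdd n i) :=
  contDiff_pi.mpr fun i => contDiff_apply ℝ ℝ (Fin.castAdd n i)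

/-- The block projections of `ℝ^{m+n}` are `C^∞`. [folklore] -/
theorem contDiff_sndBlock : ContDiff ℝ ∞ fun z : Fin (m + n) → ℝ => fun j => z (Fin.natAdd m j) :=
  contDiff_pi.mpr fun j => contDiff_apply ℝ ℝ (Fin.natAdd m j)

/-- **Products of submanifolds are submanifolds**: `S × T ⊆ ℝ^{m+n}` (as `appendProd S T`) is a
submanifold of dimension `dm + dn` (product charts; the unit ball of the sup norm is a product).
[folklore] -/
theorem isSubmanifoldOfDim_appendProd {S : Set (Fin m → ℝ)} {T : Set (Fin n → ℝ)}
    (hS : IsSubmanifoldOfDim dm S) (hT : IsSubmanifoldOfDim dn T) :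
    IsSubmanifoldOfDim (dm + dn) (appendProd S T) := by
  intro z hz
  obtain ⟨hx, hy⟩ := mem_appendProd.mp hz
  obtain ⟨c, hxU⟩ := hS.exists_chart hx
  obtain ⟨c', hyU⟩ := hT.exists_chart hy
  refine ⟨appendProd c.U c'.U,
    fun t => Fin.append (c.φ fun i => t (Fin.castAdd dn i)) (c'.φ fun j => t (Fin.natAdd dm j)),
    fun z => Fin.append (c.ψ fun i => z (Fin.castAdd n i)) (c'.ψ fun j => z (Fin.natAdd m j)),
    ?_, mem_appendProd.mpr ⟨hxU, hyU⟩, ?_, ?_, ?_, ?_⟩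
  · exact (c.isOpen_U.preimage contDiff_fstBlock.continuous).inter
      (c'.isOpen_U.preimage contDiff_sndBlock.continuous)
  · refine contDiffOn_pi.mpr fun idx => ?_
    refine Fin.addCases (motive := fun idx => ContDiffOn ℝ ∞ (fun t : Fin (dm + dn) → ℝ =>
      Fin.append (c.φ fun i => t (Fin.castAdd dn i)) (c'.φ fun j => t (Fin.natAdd dm j)) idx)
      (Metric.ball 0 1)) (fun i => ?_) (fun j => ?_) idx
    · simp only [Fin.append_left]
      exact contDiffOn_pi.mp (c.contDiffOn_φ.comp contDiff_fstBlock.contDiffOn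
        fun t ht => ((mem_ball_append_iff t).mp ht).1) i
    · simp only [Fin.append_right]
      exact contDiffOn_pi.mp (c'.contDiffOn_φ.comp contDiff_sndBlock.contDiffOn
        fun t ht => ((mem_ball_append_iff t).mp ht).2) j
  · refine contDiffOn_pi.mpr fun idx => ?_
    refine Fin.addCases (motive := fun idx => ContDiffOn ℝ ∞ (fun z : Fin (m + n) → ℝ =>
      Fin.append (c.ψ fun i => z (Fin.castAdd n i)) (c'.ψ fun j => z (Fin.natAdd m j)) idx)
      (appendProd c.U c'.U)) (fun i => ?_) (fun j => ?_) idx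
    · simp only [Fin.append_left]
      exact contDiffOn_pi.mp (c.contDiffOn_ψ.comp contDiff_fstBlock.contDiffOn
        fun z hz => (mem_appendProd.mp hz).1) i
    · simp only [Fin.append_right]
      exact contDiffOn_pi.mp (c'.contDiffOn_ψ.comp contDiff_sndBlock.contDiffOn
        fun z hz => (mem_appendProd.mp hz).2) j
  · intro t ht
    obtain ⟨ht1, ht2⟩ := (mem_ball_append_iff t).mp ht
    simp only [Fin.append_left, Fin.append_right]
    rw [c.ψ_φ _ ht1, c'.ψ_φ _ ht2]
    exact Fin.append_castAdd_natAdd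
  · ext w
    simp only [mem_image, mem_inter_iff]
    constructor
    · rintro ⟨t, ht, rfl⟩
      obtain ⟨ht1, ht2⟩ := (mem_ball_append_iff t).mp ht
      exact ⟨append_mem_appendProd.mpr ⟨(c.φ_mem ht1).1, (c'.φ_mem ht2).1⟩,
        append_mem_appendProd.mpr ⟨(c.φ_mem ht1).2, (c'.φ_mem ht2).2⟩⟩
    · rintro ⟨hw, hwU⟩
      obtain ⟨hw1, hw2⟩ := mem_appendProd.mp hw
      obtain ⟨hwU1, hwU2⟩ := mem_appendProd.mp hwU
      have h1 : (fun i => w (Fin.castAdd n i)) ∈ c.φ '' Metric.ball 0 1 := by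
        rw [c.image_eq]; exact ⟨hw1, hwU1⟩
      have h2 : (fun j => w (Fin.natAdd m j)) ∈ c'.φ '' Metric.ball 0 1 := by
        rw [c'.image_eq]; exact ⟨hw2, hwU2⟩
      obtain ⟨t₁, ht₁, hφ₁⟩ := h1
      obtain ⟨t₂, ht₂, hφ₂⟩ := h2
      refine ⟨Fin.append t₁ t₂, (mem_ball_append_iff _).mpr ⟨by simpa using ht₁, by simpa using ht₂⟩,
        ?_⟩
      simp only [Fin.append_left, Fin.append_right]
      rw [show (fun i => t₁ i) = t₁ from rfl, show (fun i => t₂ i) = t₂ from rfl, hφ₁, hφ₂]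
      exact Fin.append_castAdd_natAdd

/-- **The tangent vector `(0, u)`**: for `x ∈ S` and a tangent velocity `u` of `T` at `y`,
`(0, u)` is a tangent velocity of `S × T` at `(x, y)` (curve `s ↦ (x, γ s)`). [folklore] -/
theorem append_zero_mem_tangentVelocities_appendProd {S : Set (Fin m → ℝ)} {T : Set (Fin n → ℝ)}
    {x : Fin m → ℝ} (hx : x ∈ S) {y u : Fin n → ℝ} (hu : u ∈ tangentVelocities T y) :
    Fin.append 0 u ∈ tangentVelocities (appendProd S T) (Fin.append x y) := by
  obtain ⟨γ, hγT, hγ0, hγu⟩ := hu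
  refine ⟨fun s => Fin.append x (γ s), hγT.mono fun s hs => append_mem_appendProd.mpr ⟨hx, hs⟩,
    by simp [hγ0], ?_⟩
  refine hasDerivAt_pi.mpr fun idx => ?_
  refine Fin.addCases (motive := fun idx => HasDerivAt (fun s => Fin.append x (γ s) idx)
    (Fin.append (0 : Fin m → ℝ) u idx) 0) (fun i => ?_) (fun j => ?_) idx
  · simp only [Fin.append_left, Pi.zero_apply]
    exact hasDerivAt_const 0 (x i)
  · simp only [Fin.append_right]
    exact (hasDerivAt_pi.mp hγu) j

/-- The linear map `w ↦ (0, w) : ℝⁿ → ℝ^{m+n}`. [folklore] -/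
def appendRightCLM (m n : ℕ) : (Fin n → ℝ) →L[ℝ] (Fin (m + n) → ℝ) :=
  ContinuousLinearMap.pi fun idx =>
    Fin.addCases (motive := fun _ => (Fin n → ℝ) →L[ℝ] ℝ) (fun _ => 0)
      (fun j => ContinuousLinearMap.proj j) idx

/-- `appendRightCLM m n w = (0, w)`. [folklore] -/
theorem appendRightCLM_apply (w : Fin n → ℝ) : appendRightCLM m n w = Fin.append 0 w := by
  funext idx
  refine Fin.addCases (motive := fun idx => appendRightCLM m n w idx = Fin.append (0 : Fin m → ℝ) w idx)
    (fun i => ?_) (fun j => ?_) idx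
  · simp [appendRightCLM, Fin.addCases_left]
  · simp [appendRightCLM, Fin.addCases_right]

/-- The affine map `y ↦ (x, y)` has derivative `w ↦ (0, w)`. [folklore] -/
theorem hasFDerivAt_append_right (x : Fin m → ℝ) (y : Fin n → ℝ) :
    HasFDerivAt (fun y' : Fin n → ℝ => (Fin.append x y' : Fin (m + n) → ℝ)) (appendRightCLM m n) y := by
  have h : HasFDerivAt (fun (y' : Fin n → ℝ) (idx : Fin (m + n)) => Fin.append x y' idx)
      (ContinuousLinearMap.pi fun idx => Fin.addCases (motive := fun _ => (Fin n → ℝ) →L[ℝ] ℝ)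
        (fun _ => 0) (fun j => ContinuousLinearMap.proj j) idx) y := by
    refine hasFDerivAt_pi.mpr fun idx => ?_
    refine Fin.addCases (motive := fun idx => HasFDerivAt (fun y' : Fin n → ℝ => Fin.append x y' idx)
      (Fin.addCases (motive := fun _ => (Fin n → ℝ) →L[ℝ] ℝ) (fun _ => 0)
        (fun j => ContinuousLinearMap.proj j) idx) y) (fun i => ?_) (fun j => ?_) idx
    · simp only [Fin.append_left, Fin.addCases_left]
      exact hasFDerivAt_const (x i) y
    · simp only [Fin.append_right, Fin.addCases_right]
      exact hasFDerivAt_apply j y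
  exact h

end Products

namespace EmbeddedNashGroup

variable {N g : ℕ} (G : EmbeddedNashGroup N g)

/-! ### The two-variable translation map `H(a, y) = (−a) + y` on `ℝ^{N+N}` -/

/-- `H(a, y) = (−a) + y` as a map of `ℝ^{N+N}` (appended coordinates). [folklore] -/
def H (z : Fin (N + N) → ℝ) : Fin N → ℝ :=
  G.add (G.neg fun i => z (Fin.castAdd N i)) fun j => z (Fin.natAdd N j)

/-- `H` is `C^∞`. [folklore] -/
theorem contDiff_H : ContDiff ℝ ∞ G.H :=
  G.contDiff_add.comp ((G.contDiff_neg.comp contDiff_fstBlock).prodMk contDiff_sndBlock)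

/-- `H(x, y) = τ_x y`. [folklore] -/
theorem H_append (x y : Fin N → ℝ) : G.H (Fin.append x y) = G.add (G.neg x) y := by
  simp only [H, Fin.append_left, Fin.append_right]

/-- `H` is `ℚ`-semialgebraic on `pts × pts`. [cite: BochnakCosteRoy1998, Prop. 2.2.6] -/
theorem isSemialgebraicMapOn_H : IsSemialgebraicMapOn ℚ (appendProd G.pts G.pts) G.H := by
  have hpp : IsSemialgebraic ℚ (appendProd G.pts G.pts) :=
    isSemialgebraic_appendProd G.isSemialgebraic_pts G.isSemialgebraic_pts
  have hfst := isSemialgebraicMapOn_castAdd (m := N) (n := N) hpp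
  have hsnd := isSemialgebraicMapOn_natAdd (m := N) (n := N) hpp
  have hneg : IsSemialgebraicMapOn ℚ (appendProd G.pts G.pts)
      (G.neg ∘ fun z (i : Fin N) => z (Fin.castAdd N i)) :=
    IsSemialgebraicMapOn.comp_holds G.isSemialgebraicMapOn_neg hfst
      fun z hz => (mem_appendProd.mp hz).1
  have hΦ : IsSemialgebraicMapOn ℚ (appendProd G.pts G.pts) fun z =>
      Fin.append ((G.neg ∘ fun z (i : Fin N) => z (Fin.castAdd N i)) z) (fun j => z (Fin.natAdd N j)) :=
    hneg.append hsnd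
  have hcomp := IsSemialgebraicMapOn.comp_holds G.isSemialgebraicMapOn_add hΦ fun z hz =>
    append_mem_appendProd.mpr ⟨G.neg_mem (mem_appendProd.mp hz).1, (mem_appendProd.mp hz).2⟩
  refine hcomp.congr fun z _ => ?_
  simp only [Function.comp_apply, Fin.append_left, Fin.append_right, H]

/-- **`D(τ_x)(x) w = DH(x, x)(0, w)`** (chain rule along `y ↦ (x, y)`). [folklore] -/
theorem dtau_apply_eq (x w : Fin N → ℝ) :
    G.dtau x w = fderiv ℝ G.H (Fin.append x x) (Fin.append 0 w) := by
  have hH : HasFDerivAt G.H (fderiv ℝ G.H (Fin.append x x)) (Fin.append x x) :=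
    (G.contDiff_H.differentiable (by simp) _).hasFDerivAt
  have hcomp := hH.comp x (hasFDerivAt_append_right x x)
  have heq : (G.H ∘ fun y' : Fin N → ℝ => (Fin.append x y' : Fin (N + N) → ℝ)) =
      fun y => G.add (G.neg x) y := by
    funext y
    exact G.H_append x y
  rw [heq] at hcomp
  rw [dtau, hcomp.fderiv, ContinuousLinearMap.comp_apply, appendRightCLM_apply]

/-! ### Semialgebraicity of the coefficients -/

/-- `pts × pts` is a `2g`-dimensional submanifold. [folklore] -/
theorem isSubmanifold_prod : IsSubmanifoldOfDim (g + g) (appendProd G.pts G.pts) :=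
  isSubmanifoldOfDim_appendProd G.isSubmanifold_pts G.isSubmanifold_pts

/-- The tangent field `z = (a, y) ↦ (0, π_y e_j)` on `ℝ^{N+N}` (on the diagonal `y = a`).
[folklore] -/
def liftField (j : Fin N) (z : Fin (N + N) → ℝ) : Fin (N + N) → ℝ :=
  Fin.append 0 (orthProj (G.T fun i => z (Fin.natAdd N i)) (Pi.single j 1))

/-- The lifted field is `ℚ`-semialgebraic on `pts × pts`. [cite: BochnakCosteRoy1998, Prop. 2.2.6] -/
theorem isSemialgebraicMapOn_liftField (j : Fin N) :
    IsSemialgebraicMapOn ℚ (appendProd G.pts G.pts) (G.liftField j) := by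
  have hpp : IsSemialgebraic ℚ (appendProd G.pts G.pts) :=
    isSemialgebraic_appendProd G.isSemialgebraic_pts G.isSemialgebraic_pts
  have hsnd := isSemialgebraicMapOn_natAdd (m := N) (n := N) hpp
  have hu := isSemialgebraicMapOn_orthProj_single (k := ℚ) G.isSubmanifold_pts G.isSemialgebraic_pts j
  have hcomp := IsSemialgebraicMapOn.comp_holds hu hsnd fun z hz => (mem_appendProd.mp hz).2
  have hzero : IsSemialgebraicMapOn ℚ (appendProd G.pts G.pts) fun _ => (0 : Fin N → ℝ) := by
    convert isSemialgebraicMapOn_aeval hpp (fun _ : Fin N => (0 : MvPolynomial (Fin (N + N)) ℚ))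
      using 2 with z
    funext i
    simp
  exact hzero.append hcomp

/-- The lifted field is tangent to `pts × pts`. [folklore] -/
theorem liftField_mem_tangentSpace (j : Fin N) {z : Fin (N + N) → ℝ} (hz : z ∈ appendProd G.pts G.pts) :
    G.liftField j z ∈ tangentSpace (appendProd G.pts G.pts) z := by
  obtain ⟨hx, hy⟩ := mem_appendProd.mp hz
  rw [mem_tangentSpace_iff G.isSubmanifold_prod hz]
  have hu : orthProj (G.T fun i => z (Fin.natAdd N i)) (Pi.single j 1) ∈
      tangentVelocities G.pts (fun i => z (Fin.natAdd N i)) :=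
    (mem_tangentSpace_iff G.isSubmanifold_pts hy).mp (orthProj_mem _ _)
  have h := append_zero_mem_tangentVelocities_appendProd (S := G.pts) hx hu
  rwa [Fin.append_castAdd_natAdd] at h

/-- **The coefficients of the coframe are `ℚ`-semialgebraic on `pts`**:
`x ↦ ωᵢ(x)(e_j) = (DH(x,x)(0, π_x e_j))_{Jᵢ}` is the `Jᵢ`-th component of the derivative of the
semialgebraic map `H` along the semialgebraic tangent field `(0, π_x e_j)` of `pts × pts`, composed
with the diagonal. [cite: BochnakCosteRoy1998, Prop. 2.2.4, Prop. 2.2.6 and Prop. 3.3.11]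
[cite: BasuPollackRoy2006, Prop. 3.22 and §3.3 (derivatives of semi-algebraic functions)] -/
theorem isSemialgebraicFunOn_invForm (i : Fin g) (j : Fin N) :
    IsSemialgebraicFunOn ℚ G.pts fun x => G.invForm i x (Pi.single j 1) := by
  have hpp : IsSemialgebraic ℚ (appendProd G.pts G.pts) :=
    isSemialgebraic_appendProd G.isSemialgebraic_pts G.isSemialgebraic_pts
  -- the derivative of `H` along the lifted field, on `pts × pts`
  have hR : IsSemialgebraicMapOn ℚ (appendProd G.pts G.pts) fun z => fderiv ℝ G.H z (G.liftField j z) :=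
    isSemialgebraicMapOn_fderiv_apply G.isSubmanifold_prod hpp G.contDiff_H G.isSemialgebraicMapOn_H
      (G.isSemialgebraicMapOn_liftField j) fun z hz => G.liftField_mem_tangentSpace j hz
  -- compose with the diagonal
  have hdiag : IsSemialgebraicMapOn ℚ G.pts fun x : Fin N → ℝ => (Fin.append x x : Fin (N + N) → ℝ) :=
    (isSemialgebraicMapOn_id G.isSemialgebraic_pts).append (isSemialgebraicMapOn_id G.isSemialgebraic_pts)
  have hcomp := IsSemialgebraicMapOn.comp_holds hR hdiag fun x hx => append_mem_appendProd.mpr ⟨hx, hx⟩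
  have hfun := (isSemialgebraicMapOn_iff_forall_holds G.isSemialgebraic_pts).mp hcomp (G.J i)
  refine hfun.congr fun x hx => ?_
  simp only [Function.comp_apply, invForm_apply, liftField, Fin.append_right]
  rw [G.dtau_apply_eq, G.proj_eq hx]


/-! ### Velocities of translated curves -/

/-- **Velocity transport by `τ_a`**: if `γ` has velocity `v` at `0` and `γ 0 = a`, then
`s ↦ τ_a (γ s) = (−a) + γ s` has velocity `D(τ_a)(a) v`. [folklore] -/
theorem hasDerivAt_tau_comp {a : Fin N → ℝ} {γ : ℝ → Fin N → ℝ} {v : Fin N → ℝ} (hγ0 : γ 0 = a)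
    (hγ : HasDerivAt γ v 0) : HasDerivAt (fun s => G.add (G.neg a) (γ s)) (G.dtau a v) 0 := by
  have h : HasFDerivAt (fun y => G.add (G.neg a) y) (G.dtau a) (γ 0) := by
    rw [hγ0]
    exact ((G.contDiff_tau a).differentiable (by simp) a).hasFDerivAt
  exact h.comp_hasDerivAt (0 : ℝ) hγ

/-- **The differential of the group law at `(0, 0)` is addition**: for curves `α`, `β` in `pts`
through `0` with velocities `a`, `b`, the curve `α + β` has velocity `a + b` (since `x + 0 = x`
and `0 + y = y` on `pts`). [cite: LeeSmoothManifolds2013, Problem 7-2] -/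
theorem hasDerivAt_add_of_zero {α β : ℝ → Fin N → ℝ} {a b : Fin N → ℝ}
    (hαS : ∀ᶠ s in 𝓝 (0 : ℝ), α s ∈ G.pts) (hβS : ∀ᶠ s in 𝓝 (0 : ℝ), β s ∈ G.pts)
    (hα0 : α 0 = G.zero) (hβ0 : β 0 = G.zero) (hα : HasDerivAt α a 0) (hβ : HasDerivAt β b 0) :
    HasDerivAt (fun s => G.add (α s) (β s)) (a + b) 0 := by
  set M := fderiv ℝ (fun p : (Fin N → ℝ) × (Fin N → ℝ) => G.add p.1 p.2) (G.zero, G.zero) with hM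
  have hMd : HasFDerivAt (fun p : (Fin N → ℝ) × (Fin N → ℝ) => G.add p.1 p.2) M (G.zero, G.zero) :=
    (G.contDiff_add.differentiable (by simp) _).hasFDerivAt
  -- the curve `(α, β)`
  have h1 : HasDerivAt (fun s => G.add (α s) (β s)) (M (a, b)) 0 := by
    have hM' : HasFDerivAt (fun p : (Fin N → ℝ) × (Fin N → ℝ) => G.add p.1 p.2) M (α 0, β 0) := by
      rw [hα0, hβ0]
      exact hMd
    exact hM'.comp_hasDerivAt (0 : ℝ) (hα.prodMk hβ)
  -- the curve `(α, 0)`: `M (a, 0) = a`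
  have h2 : M (a, 0) = a := by
    have hM' : HasFDerivAt (fun p : (Fin N → ℝ) × (Fin N → ℝ) => G.add p.1 p.2) M (α 0, G.zero) := by
      rw [hα0]
      exact hMd
    have hd := hM'.comp_hasDerivAt (0 : ℝ) (hα.prodMk (hasDerivAt_const (0 : ℝ) G.zero))
    have hd' : HasDerivAt (fun s => G.add (α s) G.zero) a 0 :=
      hα.congr_of_eventuallyEq (hαS.mono fun s hs => G.add_zero hs)
    exact hd.unique hd'
  -- the curve `(0, β)`: `M (0, b) = b`
  have h3 : M (0, b) = b := by
    have hM' : HasFDerivAt (fun p : (Fin N → ℝ) × (Fin N → ℝ) => G.add p.1 p.2) M (G.zero, β 0) := by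
      rw [hβ0]
      exact hMd
    have hd := hM'.comp_hasDerivAt (0 : ℝ) ((hasDerivAt_const (0 : ℝ) G.zero).prodMk hβ)
    have hd' : HasDerivAt (fun s => G.add G.zero (β s)) b 0 :=
      hβ.congr_of_eventuallyEq (hβS.mono fun s hs => G.zero_add _ hs)
    exact hd.unique hd'
  have hsplit : M (a, b) = a + b := by
    have : ((a, b) : (Fin N → ℝ) × (Fin N → ℝ)) = (a, 0) + (0, b) := by simp
    rw [this, map_add, h2, h3]
  rw [← hsplit]
  exact h1

/-! ### Additivity of the coframe -/

/-- **Additivity** `ρ^*ωᵢ = pr₁^*ωᵢ + pr₂^*ωᵢ` on tangent vectors: for curves `γ₁`, `γ₂` in `pts`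
with velocities `v₁`, `v₂` and `w` the velocity of `γ₁ + γ₂`,
`ωᵢ(γ₁ 0 + γ₂ 0)(w) = ωᵢ(γ₁ 0)(v₁) + ωᵢ(γ₂ 0)(v₂)`. In the commutative group
`τ_{a+b}(γ₁ + γ₂) = τ_a γ₁ + τ_b γ₂`, whose velocity at `0` is the sum of the velocities
(`hasDerivAt_add_of_zero`). [cite: Serre1988, Ch. III no. 11, Prop. 17 (proof)] -/
theorem invForm_add (i : Fin g) {γ₁ γ₂ : ℝ → Fin N → ℝ} {v₁ v₂ w : Fin N → ℝ}
    (h₁ : ∀ᶠ s in 𝓝 (0 : ℝ), γ₁ s ∈ G.pts) (h₂ : ∀ᶠ s in 𝓝 (0 : ℝ), γ₂ s ∈ G.pts)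
    (hv₁ : HasDerivAt γ₁ v₁ 0) (hv₂ : HasDerivAt γ₂ v₂ 0)
    (hw : HasDerivAt (fun s => G.add (γ₁ s) (γ₂ s)) w 0) :
    G.invForm i (G.add (γ₁ 0) (γ₂ 0)) w = G.invForm i (γ₁ 0) v₁ + G.invForm i (γ₂ 0) v₂ := by
  have ha : γ₁ 0 ∈ G.pts := h₁.self_of_nhds
  have hb : γ₂ 0 ∈ G.pts := h₂.self_of_nhds
  have hab : G.add (γ₁ 0) (γ₂ 0) ∈ G.pts := G.add_mem ha hb
  have hv₁T : v₁ ∈ G.T (γ₁ 0) := (mem_tangentSpace_iff G.isSubmanifold_pts ha).mpr ⟨γ₁, h₁, rfl, hv₁⟩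
  have hv₂T : v₂ ∈ G.T (γ₂ 0) := (mem_tangentSpace_iff G.isSubmanifold_pts hb).mpr ⟨γ₂, h₂, rfl, hv₂⟩
  have hwT : w ∈ G.T (G.add (γ₁ 0) (γ₂ 0)) :=
    (mem_tangentSpace_iff G.isSubmanifold_pts hab).mpr
      ⟨fun s => G.add (γ₁ s) (γ₂ s), (h₁.and h₂).mono fun s hs => G.add_mem hs.1 hs.2, rfl, hw⟩
  simp only [invForm_apply]
  rw [G.proj_eq hab, G.proj_eq ha, G.proj_eq hb, orthProj_eq_self _ hwT, orthProj_eq_self _ hv₁T,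
    orthProj_eq_self _ hv₂T]
  suffices h : G.dtau (G.add (γ₁ 0) (γ₂ 0)) w = G.dtau (γ₁ 0) v₁ + G.dtau (γ₂ 0) v₂ by
    rw [h, Pi.add_apply]
  have hd₁ := G.hasDerivAt_tau_comp rfl hv₁
  have hd₂ := G.hasDerivAt_tau_comp rfl hv₂
  have hd := G.hasDerivAt_tau_comp (γ := fun s => G.add (γ₁ s) (γ₂ s)) rfl hw
  have heq : (fun s => G.add (G.add (G.neg (γ₁ 0)) (γ₁ s)) (G.add (G.neg (γ₂ 0)) (γ₂ s))) =ᶠ[𝓝 0]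
      fun s => G.add (G.neg (G.add (γ₁ 0) (γ₂ 0))) (G.add (γ₁ s) (γ₂ s)) :=
    (h₁.and h₂).mono fun s hs => (G.neg_add_add_add ha hb hs.1 hs.2).symm
  have hd' := hd.congr_of_eventuallyEq heq
  have hsum : HasDerivAt (fun s => G.add (G.add (G.neg (γ₁ 0)) (γ₁ s)) (G.add (G.neg (γ₂ 0)) (γ₂ s)))
      (G.dtau (γ₁ 0) v₁ + G.dtau (γ₂ 0) v₂) 0 :=
    G.hasDerivAt_add_of_zero (h₁.mono fun s hs => G.add_mem (G.neg_mem ha) hs)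
      (h₂.mono fun s hs => G.add_mem (G.neg_mem hb) hs) (G.neg_add_cancel _ ha)
      (G.neg_add_cancel _ hb) hd₁ hd₂
  exact hd'.unique hsum

/-! ### The frame property -/

/-- **`D(τ_x)(x)` carries tangent vectors at `x` to tangent vectors at `0`.** [folklore] -/
theorem dtau_mem_T_zero {x v : Fin N → ℝ} (hx : x ∈ G.pts) (hv : v ∈ tangentVelocities G.pts x) :
    G.dtau x v ∈ G.T G.zero := by
  obtain ⟨γ, hγS, hγ0, hγv⟩ := hv
  exact (mem_tangentSpace_iff G.isSubmanifold_pts G.zero_mem).mpr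
    ⟨fun s => G.add (G.neg x) (γ s), hγS.mono fun s hs => G.add_mem (G.neg_mem hx) hs,
      by simp only [hγ0, G.neg_add_cancel x hx], G.hasDerivAt_tau_comp hγ0 hγv⟩

/-- **`D(τ_x)(x)` is injective on tangent vectors**: a tangent velocity killed by `D(τ_x)(x)`
vanishes (`γ = σ_x ∘ τ_x ∘ γ` near `0`). [folklore] -/
theorem eq_zero_of_dtau_eq_zero {x v : Fin N → ℝ} (hx : x ∈ G.pts) (hv : v ∈ tangentVelocities G.pts x)
    (h0 : G.dtau x v = 0) : v = 0 := by
  obtain ⟨γ, hγS, hγ0, hγv⟩ := hv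
  have hd := G.hasDerivAt_tau_comp hγ0 hγv
  have hσ : HasFDerivAt (fun y => G.add x y) (fderiv ℝ (fun y => G.add x y) G.zero)
      (G.add (G.neg x) (γ 0)) := by
    rw [hγ0, G.neg_add_cancel x hx]
    exact ((G.contDiff_add_right x).differentiable (by simp) _).hasFDerivAt
  have hcomp := hσ.comp_hasDerivAt (0 : ℝ) hd
  have heq : (fun s => G.add x (G.add (G.neg x) (γ s))) =ᶠ[𝓝 0] γ :=
    hγS.mono fun s hs => G.add_neg_add hx hs
  have hγv' : HasDerivAt γ (fderiv ℝ (fun y => G.add x y) G.zero (G.dtau x v)) 0 :=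
    hcomp.congr_of_eventuallyEq heq.symm
  rw [h0, map_zero] at hγv'
  exact hγv.unique hγv'

/-- **`D(τ_x)(x)` maps the tangent velocities at `x` ONTO those at `0`**: `u ∈ T_0` is
`D(τ_x)(x) v` for the velocity `v` of `σ_x ∘ δ`, `δ` a curve with velocity `u`. [folklore] -/
theorem exists_dtau_eq {x u : Fin N → ℝ} (hx : x ∈ G.pts) (hu : u ∈ tangentVelocities G.pts G.zero) :
    ∃ v ∈ tangentVelocities G.pts x, G.dtau x v = u := by
  obtain ⟨δ, hδS, hδ0, hδu⟩ := hu
  have hσ : HasFDerivAt (fun y => G.add x y) (fderiv ℝ (fun y => G.add x y) G.zero) (δ 0) := by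
    rw [hδ0]
    exact ((G.contDiff_add_right x).differentiable (by simp) _).hasFDerivAt
  have hγ : HasDerivAt (fun s => G.add x (δ s)) (fderiv ℝ (fun y => G.add x y) G.zero u) 0 :=
    hσ.comp_hasDerivAt (0 : ℝ) hδu
  have hγS : ∀ᶠ s in 𝓝 (0 : ℝ), G.add x (δ s) ∈ G.pts := hδS.mono fun s hs => G.add_mem hx hs
  have hγ0 : G.add x (δ 0) = x := by rw [hδ0, G.add_zero hx]
  refine ⟨fderiv ℝ (fun y => G.add x y) G.zero u, ⟨_, hγS, hγ0, hγ⟩, ?_⟩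
  have hd := G.hasDerivAt_tau_comp hγ0 hγ
  have heq : (fun s => G.add (G.neg x) (G.add x (δ s))) =ᶠ[𝓝 0] δ :=
    hδS.mono fun s hs => G.neg_add_add hx hs
  exact (hd.congr_of_eventuallyEq heq.symm).unique hδu |>.symm ▸ rfl

/-- **The coframe property**: at every `x ∈ pts` the `ωᵢ(x)` separate the tangent vectors and are
linearly independent on them (`D(τ_x)(x) : T_x ≅ T_0`, and the `J`-coordinates form a basis of
`T_0^*`). [cite: Serre1988, Ch. III no. 11, Prop. 16 Cor. 1] -/
theorem invForm_frame {x : Fin N → ℝ} (hx : x ∈ G.pts) :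
    (∀ v ∈ tangentVelocities G.pts x, (∀ i, G.invForm i x v = 0) → v = 0) ∧
      ∀ c : Fin g → ℝ, (∀ v ∈ tangentVelocities G.pts x, ∑ i, c i * G.invForm i x v = 0) → c = 0 := by
  have hproj : ∀ v ∈ tangentVelocities G.pts x, G.proj x v = v := fun v hv => by
    rw [G.proj_eq hx]
    exact orthProj_eq_self _ ((mem_tangentSpace_iff G.isSubmanifold_pts hx).mpr hv)
  constructor
  · intro v hv h0
    have hu0 : G.dtau x v = 0 := by
      refine G.J_separates (G.dtau_mem_T_zero hx hv) fun i => ?_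
      have h := h0 i
      rwa [invForm_apply, hproj v hv] at h
    exact G.eq_zero_of_dtau_eq_zero hx hv hu0
  · intro c hc
    refine G.J_independent fun u hu => ?_
    rw [mem_tangentSpace_iff G.isSubmanifold_pts G.zero_mem] at hu
    obtain ⟨v, hv, hvu⟩ := G.exists_dtau_eq hx hu
    have key := hc v hv
    simp only [invForm_apply, hproj v hv, hvu] at key
    exact key

/-! ### The packaged structure -/

/-- **An embedded compact abelian Nash group with its invariant coframe** is a
`CompactAbelianNashGroup` in the sense of `RealAlgebraic/RealAbelJacobi`.
[cite: Serre1988, Ch. III no. 11, Prop. 16 Cor. 1 and Prop. 17] -/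
def toCompactAbelianNashGroup : CompactAbelianNashGroup N g where
  pts := G.pts
  isCompact_pts := G.isCompact_pts
  isSemialgebraic_pts := G.isSemialgebraic_pts
  isSubmanifold_pts := G.isSubmanifold_pts
  add := G.add
  zero := G.zero
  neg := G.neg
  contDiffAt_add := fun _ _ _ _ => G.contDiff_add.contDiffAt
  contDiffAt_neg := fun _ _ => G.contDiff_neg.contDiffAt
  isSemialgebraicMapOn_add := G.isSemialgebraicMapOn_add
  isSemialgebraicMapOn_neg := G.isSemialgebraicMapOn_neg
  zero_mem := G.zero_mem
  add_mem := G.add_mem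
  neg_mem := G.neg_mem
  add_assoc := G.add_assoc
  add_comm := G.add_comm
  zero_add := G.zero_add
  neg_add_cancel := G.neg_add_cancel
  invForm := G.invForm
  contDiffAt_invForm := fun i _ _ => (G.contDiff_invForm i).contDiffAt
  isSemialgebraicFunOn_invForm := G.isSemialgebraicFunOn_invForm
  invForm_add := fun i _ _ _ _ _ h₁ h₂ hv₁ hv₂ hw => G.invForm_add i h₁ h₂ hv₁ hv₂ hw
  invForm_frame := fun _ hx => G.invForm_frame hx

/-- The packaged structure has the same underlying set. [folklore] -/
@[simp] theorem toCompactAbelianNashGroup_pts : G.toCompactAbelianNashGroup.pts = G.pts := rfl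

/-- … the same group law. [folklore] -/
@[simp] theorem toCompactAbelianNashGroup_add : G.toCompactAbelianNashGroup.add = G.add := rfl

/-- … the same neutral element. [folklore] -/
@[simp] theorem toCompactAbelianNashGroup_zero : G.toCompactAbelianNashGroup.zero = G.zero := rfl

/-- … the same inversion. [folklore] -/
@[simp] theorem toCompactAbelianNashGroup_neg : G.toCompactAbelianNashGroup.neg = G.neg := rfl

/-- … and the constructed coframe. [folklore] -/
@[simp] theorem toCompactAbelianNashGroup_invForm :
    G.toCompactAbelianNashGroup.invForm = G.invForm := rfl

end EmbeddedNashGroup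

end Literature.AlgebraicGeometry.RealAlgebraic

end
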